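/-
Copyright (c) 2026 the pub-hodgecm-mathlib formalisation cell (harness21).  Prover seat hodgecm-mathlib-LH4-p19 (g0), req620 Track A «(D-RAM) FOUR-FRAME» squad
(STAGE-1b, row (2) of the piece `f_{T₊}`, the (β₂) road (R-36) «PURE-CELL LEDGER»; β₂ sub-dealer LH4-p04 (g8) BETA2-BOARD v1.1 row (L-D×) «cross-literal sign law of the
diagonal cell, `cellDiff₂(D) = −cellDiff₁(D)`»; heir LEAD F0P3a-plan (g21) T20-19 «RELATIVE SIGNS, NEVER σ(u)»), 2026-09-04.
-/
import Summits.HodgeConjecture.HodgeConjecture.Theorems.F0P3cDyRamDepthFormLineModel   -- ★ p861372 (LH4-p16 (g0)) HEAD B `valueSet_endoGL_sub_one_glued_eq_normFormSet_of_gen`; brings ★ p861311, ★ p861015 `pairing_self_eq_plane_add_line`, ★ DEFS `dualGen`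
import Summits.HodgeConjecture.HodgeConjecture.Theorems.F0P3cDyRamSmulXPlusLabel         -- ★ (L-lab-3) (LH4-p15) `valueSetMod_smul_xPlus`; brings ★ №3 `xPlus ∕ valueSetMod`
import HarnessLib

/-!
# Crux `H413`, line LH4 «(D-RAM) FOUR-FRAME» — STAGE-1b, row (2), the (β₂) road (R-36), row (L-D×): «THE LETTER OF THE DIAGONAL CELL IS `(f·h_W) • X₊`» — on the
# diagonal cone cell `D` (order level = tube depth = `b`, `|lam − jE u₀₀| = |ϖ|^{2b}`) the census value set of EVERY integral glued vertex is
# `valueSetMod σ ϖ m ((f·h_W) • X₊)` with ONE `σ`-fixed unit `f` read off `lam − jE u₀₀` (literal-free) times the LINE ENTRY `h_W` of the block form;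
# hence the two literals (`h_W = 1` hyperbolic, `h_W = η` a non-norm, anisotropic) carry OPPOSITE constant labels on `D`: `cellDiff₂(D) = −cellDiff₁(D)`

Cell `hodgecm-mathlib` (D-0151), FLOOR 0, crux item H413 = `stmt-HodgeConjecture-24833`, route of record `HCCMUnconditional`; squad F0∕P3c∕LH4; lane
`--supports stmt-HodgeConjecture-24833 --as helper` (count-neutral; pays NO tier-0 row).  THEOREMS ONLY (no `def`, no instance, no notation, no `sorry`, default heartbeats);
★-only imports; states NO law; (β₂) stays a HYPOTHESIS.  DATUM-FREE: the plane `(E², H₂)` with `σ`, `|ϖ| = exp(−1)`, block form `H = block(H₂, h_W)`, `Γ = endoGL (γ₂, u)`,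
★ (C1)'s line model `(M, jE, ρ, Θ; φ, lam, h_M)` and ★ p861372's glue∕generator letters; no residue field, no `|2|`, no self-duality beyond integrality.

THE MECHANISM (memo `F0/P3c/LH4/LH4-p19/g0/MECH-LDx.v1.LH4p19g0.md` 7b7d82cf; model check `dcell_experiment.v1.LH4p19g0.py` reproduces LH4-cdis1 (g0)'s table: δ ≥ 4 antisymmetric
PURE, δ = 2 balanced, δ = 0 mixed 1:3 symmetric).  ★ p861372 HEAD B writes the letter of the vertex over `Λ = x₀·𝒪_j` as the `ϖ^m`-value set of `(ζ, a) ↦ Tr_ρ(μ·N_Θ(Yζ + jE a)·T)`,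
`T = 1∕(cc(α − ρα)·ΘY)`, `μ = lam − jE u₀₀`.  ON THE DIAGONAL CELL (`|Y| = |cc(α − ρα)| = |jEϖ|^b`, so `|T| = |jEϖ|^{−2b} = |μ|⁻¹`):
* the cross terms of `N_Θ(Yζ + jE a) = jE(aσa) + [YζΘ(Yζ)] + [w + Θw]`, `w = jE a·Θ(Yζ)`, are `ϖ^m`-SMALL once `m ≤ 2b` and `Θ`-traces of `𝔭_M^b` lie in `𝔭^m` (`htrace`; at a wild
  datum: `Tr_{E∕F}(𝔭_E^b) ⊂ 𝔭_E^m`, i.e. `b ≥ d` at `m = m*`);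
* `Tr_ρ(T) = jE⟨w₀, w₀⟩_{H₂}` (★ p861372 `herm_dualGenInv_mul_eq`), and INTEGRALITY of the glue generator `g₀ = ι_W w₀ + (g₀ 1)·e₁` gives `⟨w₀, w₀⟩_{H₂} ≡ −σ(g₀ 1)·h_W·(g₀ 1)`
  (★ p861015 `pairing_self_eq_plane_add_line`) — THIS is where the literal enters: only through the line entry `h_W`;
* `μ ≡ −jE(f·t₊·(ϖσϖ)^b)` modulo `𝔭^{2b+m}` for a scalar `f` (`hlam`; at the CM place `f` is a `σ`-fixed unit when `δ = jλ − 2b` is large: the CLEAN regime).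
So every value is `≡ jE( f·h_W·t₊·N(ϖ^b·g₀ 1·a) )` and the letter is `{z ∣ ∃ |a| ≤ 1, |(ϖ^m)⁻¹(z − (f·h_W)·(t₊·(aσa)))| ≤ 1}` = `valueSetMod σ ϖ m ((f·h_W) • X₊)` at `t₊ = ` ★ №3's
reference skew scalar.  With ★ p861154's class dictionary: label `+` ⟺ `f·h_W ∈ N(E^×)`; literal 1 (`h_W = 1`) and literal 2 (`h_W = η ∉ N`) disagree on EVERY populated vertex of
`D`, which is therefore PURE on both sides with opposite signs; with ★ p861334 §5 (`Σᶠ_D f = q_E^b·q^b` on both literals) this is (L-D×) `cellDiff₂(D) = −cellDiff₁(D)`.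
* §1 valuation helpers (`v_inv_mul_sub_add_le_one_iff`: the thickening absorbs a small addend; `exists_v_le_one_mul_unit_iff`: unit reparametrisation of `{N(a)}`).
* §2 `v_normTheta_sub_norm_le` (the cross terms die), `v_normFormTrace_sub_main_le_of_diag` — THE ESTIMATE `|Tr_ρ(μ·N_Θ(Yζ + jE a)·D₀⁻¹) − jE(f·h_W·t₊·N(ϖ^b·g₀ 1·a))| ≤ |jEϖ|^m`
  in HEAD B's letters (`Tr_ρ(D₀⁻¹) = jE pw`, `|pw + σ(g₁)h_W g₁| ≤ 1`).
* §3 `inv_add_map_inv_eq_map_pairing` (`Tr_ρ(D₀⁻¹) = jE⟨w₀, w₀⟩_{H₂}`) and HEAD `valueSet_endoGL_sub_one_glued_eq_smul_xPlus_of_diag` — the letter of the vertex is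
  `valueSetMod σ ϖ m ((f·h_W) • xPlus σ ϖ d)` (general block form `(H₂, h_W)`; the `VS_H` letters of BETA2-BOARD §0).
The CROSS-LITERAL FACE (`S₁ = VS(X₊) ↔ ¬ S₂ = VS(X₊)` for line entries `h₁ ∈ N`, `h₂ ∉ N`) and the (L-D×) indicator algebra `cellDiff₂(D) = −cellDiff₁(D)` are the sibling file
`F0P3cDyRamDiagonalCellCrossLiteral` (same seat).
WHAT IS NOT CLAIMED: the regime — `hlam` with a `σ`-fixed UNIT `f` is the «clean∕deep» regime (model: δ ≥ m* + 1); for small δ the diagonal cell is balanced (δ = 2) or mixed and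
literal-SYMMETRIC (δ = 0, LH4-cdis1 15:32:52Z) and belongs to (L-P), not to this row.
HONEST LABEL.  Count-neutral lattice algebra; nothing printed is asserted; no census law is stated; `HC_CM` is proved only modulo the 7 printed citations (2 remaining named inputs:
hLiu418 = `stmt-HodgeConjecture-24832`, h413 = `stmt-HodgeConjecture-24833`) until rung 0 closes.
## References
* [Jacobowitz1962] R. Jacobowitz, *Hermitian forms over local fields*, Amer. J. Math. 84 (1962): §4 (dual lattices, modular components, gluing).
* [Rogawski1990] J. D. Rogawski, *Automorphic Representations of Unitary Groups in Three Variables*, Ann. of Math. Stud. 123 (1990): §4.9 Prop. 4.9.1 (b) p. 55 (the labelled census of `f_{T₊}`), §12.2.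
* [Kottwitz1986BaseChangeUnits] R. E. Kottwitz, *Base change for unit elements of Hecke algebras*, Compositio Math. 60 (1986): §1 pp. 240–241.
* [LanglandsShelstad1987] R. P. Langlands, D. Shelstad, *On the definition of transfer factors*, Math. Ann. 278 (1987): §1–§3 (κ-signs on a stable class).
* [Serre1979] J.-P. Serre, *Local Fields*, GTM 67 (1979): Ch. V §3 Cor. 3 (norm classes of units).
-/

set_option autoImplicit false

noncomputable section

namespace Summit.HodgeConjecture.HodgeConjecture.Cruxes.H413.F0P3cDyRamDiagonalCellLetter

open scoped Valued WithZero Matrix MatrixGroups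
open WithZero
open Literature.NumberTheory.Automorphic Literature.NumberTheory.Automorphic.HermitianLattice Literature.NumberTheory.Automorphic.UnitaryLatticeTree
open Literature.NumberTheory.Automorphic.UnitaryThreeFourFrame (IsRamifiedQuadraticDatum)
open Literature.NumberTheory.Rogawski1990
open Summit.HodgeConjecture.HodgeConjecture.Cruxes.H413.F0P3cDyRamToricCensusDefs
open Summit.HodgeConjecture.HodgeConjecture.Cruxes.H413.F0P3cDyRamFourFramePieces
open Summit.HodgeConjecture.HodgeConjecture.Cruxes.H413.F0P3cDyRamDepthFormLineModel
open Summit.HodgeConjecture.HodgeConjecture.Cruxes.H413.F0P3cDyRamBlockGlueLabelFibreConstant (pairing_self_eq_plane_add_line)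
open Summit.HodgeConjecture.HodgeConjecture.Cruxes.H413.F0P3cDyRamSmulXPlusLabel (valueSetMod_smul_xPlus)

/-! ## §1 Valuation helpers -/

section Helpers

variable {K : Type*} [Field K] [Valued K ℤᵐ⁰]

/-- **THE THICKENING ABSORBS A SMALL ADDEND**: if `|e| ≤ |P|` (`P ≠ 0`) then `|P⁻¹(X − (V + e))| ≤ 1 ↔ |P⁻¹(X − V)| ≤ 1`. [cite: Jacobowitz1962, §4] -/
theorem v_inv_mul_sub_add_le_one_iff {P X V e : K} (hP : P ≠ 0) (he : Valued.v e ≤ Valued.v P) :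
    Valued.v (P⁻¹ * (X - (V + e))) ≤ 1 ↔ Valued.v (P⁻¹ * (X - V)) ≤ 1 := by
  have hPv : Valued.v P ≠ 0 := (Valuation.ne_zero_iff _).2 hP
  have he' : Valued.v (P⁻¹ * e) ≤ 1 := by
    rw [Valuation.map_mul, map_inv₀]
    calc (Valued.v P)⁻¹ * Valued.v e ≤ (Valued.v P)⁻¹ * Valued.v P := by gcongr
      _ = 1 := inv_mul_cancel₀ hPv
  constructor
  · intro h
    have e1 : P⁻¹ * (X - V) = P⁻¹ * (X - (V + e)) + P⁻¹ * e := by ring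
    rw [e1]
    exact (Valuation.map_add _ _ _).trans (max_le h he')
  · intro h
    have e1 : P⁻¹ * (X - (V + e)) = P⁻¹ * (X - V) + -(P⁻¹ * e) := by ring
    rw [e1]
    exact (Valuation.map_add _ _ _).trans (max_le h (by rwa [Valuation.map_neg]))

/-- **UNIT REPARAMETRISATION OF AN `{|a| ≤ 1}`-INDEXED SET**: for a unit `u₀`, `(∃ |a| ≤ 1, Φ(u₀·a)) ↔ (∃ |a| ≤ 1, Φ a)`. [cite: Serre1979, Ch. V §3 Cor. 3] -/
theorem exists_v_le_one_mul_unit_iff {u₀ : K} (hu₀ : Valued.v u₀ = 1) (Φ : K → Prop) :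
    (∃ a : K, Valued.v a ≤ 1 ∧ Φ (u₀ * a)) ↔ (∃ a : K, Valued.v a ≤ 1 ∧ Φ a) := by
  have hu0 : u₀ ≠ 0 := fun h0 => by rw [h0, map_zero] at hu₀; exact zero_ne_one hu₀
  constructor
  · rintro ⟨a, ha, hΦ⟩
    exact ⟨u₀ * a, by rw [Valuation.map_mul, hu₀, one_mul]; exact ha, hΦ⟩
  · rintro ⟨a, ha, hΦ⟩
    exact ⟨u₀⁻¹ * a, by rw [Valuation.map_mul, map_inv₀, hu₀, inv_one, one_mul]; exact ha, by rwa [mul_inv_cancel_left₀ hu0]⟩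

/-- `|x + ρ x| ≤ C` for an isometric `ρ` once `|x| ≤ C`. [cite: Serre1979, Ch. V §3 Cor. 3] -/
theorem v_add_map_le_of_le (ρ : K →+* K) (hvρ : ∀ x, Valued.v (ρ x) = Valued.v x) {x : K} {C : ℤᵐ⁰} (hx : Valued.v x ≤ C) :
    Valued.v (x + ρ x) ≤ C :=
  (Valuation.map_add _ _ _).trans (max_le hx (by rw [hvρ]; exact hx))

end Helpers

/-! ## §2 The estimate on the diagonal cell, in ★ p861372 HEAD B's letters -/

section Estimate

variable {E M : Type*} [Field E] [Valued E ℤᵐ⁰] [Field M] [Valued M ℤᵐ⁰] {ρ Θ : M →+* M}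

/-- `|jE c| ≤ |jE ϖ|^0 = 1`-type transport: `|c| ≤ 1 → |jE c| ≤ 1`. [cite: Jacobowitz1962, §4] -/
theorem v_map_le_one_of_le (jE : E →+* M) (hjv : ∀ c, Valued.v (jE c) ≤ 1 ↔ Valued.v c ≤ 1) {c : E} (hc : Valued.v c ≤ 1) :
    Valued.v (jE c) ≤ 1 := (hjv c).2 hc

/-- **THE CROSS TERMS OF THE NORM FORM DIE ON THE DIAGONAL CELL**: with `N = (Yζ + jE a)·Θ(Yζ + jE a)`, `|Y| ≤ |jEϖ|^b`, `|ζ|, |a| ≤ 1`, `m ≤ 2b` and the trace hypothesis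
`htrace` (`Θ`-traces of `𝔭_M^b` lie in `𝔭^m`): `|N − jE(aσa)| ≤ |jEϖ|^m` — `N − jE(aσa) = YζΘ(Yζ) + (w + Θw)`, `w = jE a·Θ(Yζ)`. [cite: Jacobowitz1962, §4] [cite: Serre1979, Ch. V §3 Cor. 3] -/
theorem v_normTheta_sub_norm_le (σ : E →+* E) {ϖ : E} (hϖ1 : Valued.v ϖ ≤ 1) (jE : E →+* M) (hjv : ∀ c, Valued.v (jE c) ≤ 1 ↔ Valued.v c ≤ 1)
    (hΘΘ : ∀ x, Θ (Θ x) = x) (hvΘ : ∀ x, Valued.v (Θ x) = Valued.v x) (hΘj : ∀ c, Θ (jE c) = jE (σ c))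
    {Y : M} {b : ℕ} (hYv : Valued.v Y ≤ Valued.v (jE ϖ) ^ b) {m : ℕ} (hmb : m ≤ 2 * b)
    (htrace : ∀ w : M, Valued.v w ≤ Valued.v (jE ϖ) ^ b → Valued.v (w + Θ w) ≤ Valued.v (jE ϖ) ^ m)
    {ζ : M} (hζ : Valued.v ζ ≤ 1) {a : E} (ha : Valued.v a ≤ 1) :
    Valued.v ((Y * ζ + jE a) * Θ (Y * ζ + jE a) - jE (a * σ a)) ≤ Valued.v (jE ϖ) ^ m := by
  have hπ1 : Valued.v (jE ϖ) ≤ 1 := (hjv ϖ).2 hϖ1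
  have hYζ : Valued.v (Y * ζ) ≤ Valued.v (jE ϖ) ^ b := by
    rw [Valuation.map_mul]
    calc Valued.v Y * Valued.v ζ ≤ Valued.v (jE ϖ) ^ b * 1 := by gcongr
      _ = Valued.v (jE ϖ) ^ b := mul_one _
  have hπmb : Valued.v (jE ϖ) ^ (2 * b) ≤ Valued.v (jE ϖ) ^ m := pow_le_pow_right_of_le_one' hπ1 hmb
  -- the decomposition
  have hdec : (Y * ζ + jE a) * Θ (Y * ζ + jE a) - jE (a * σ a) =
      (Y * ζ) * Θ (Y * ζ) + (jE a * Θ (Y * ζ) + Θ (jE a * Θ (Y * ζ))) := by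
    rw [map_add, map_mul Θ (jE a), hΘΘ, hΘj, map_mul jE a]
    ring
  rw [hdec]
  refine (Valuation.map_add _ _ _).trans (max_le ?_ (htrace _ ?_))
  · rw [Valuation.map_mul, hvΘ]
    calc Valued.v (Y * ζ) * Valued.v (Y * ζ) ≤ Valued.v (jE ϖ) ^ b * Valued.v (jE ϖ) ^ b := by gcongr
      _ = Valued.v (jE ϖ) ^ (2 * b) := by rw [two_mul, pow_add]
      _ ≤ Valued.v (jE ϖ) ^ m := hπmb
  · rw [Valuation.map_mul, hvΘ]
    calc Valued.v (jE a) * Valued.v (Y * ζ) ≤ 1 * Valued.v (jE ϖ) ^ b := by gcongr; exact (hjv a).2 ha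
      _ = Valued.v (jE ϖ) ^ b := one_mul _

/-- **THE ESTIMATE OF (L-D×)** (★ p861372 HEAD B's letters: `Y` the dual generator, `D₀ = cc(α − ρα)·ΘY`, the value `Tr_ρ(μ·N_Θ(Yζ + jE a)·D₀⁻¹)`).  ON THE DIAGONAL CELL
(`|Y| ≤ |jEϖ|^b`, `|D₀| = |jEϖ|^{2b}`), with `Tr_ρ(D₀⁻¹) = jE pw` (`pw = ⟨w₀, w₀⟩_{H₂}`), an INTEGRAL glue generator (`|pw + σ(g₁)·h_W·g₁| ≤ 1`, `|g₁|·|ϖ|^b = 1`), `m ≤ 2b`, the trace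
hypothesis `htrace`, and `μ ≡ −jE(f·t·(ϖσϖ)^b)` modulo `|jEϖ|^{2b+m}` (`|f·t| ≤ 1`): for all `|ζ| ≤ 1`, `|a| ≤ 1`,
`|Tr_ρ(μ·N_Θ(Yζ + jE a)·D₀⁻¹) − jE(f·h_W·(t·N(ϖ^b·g₁·a)))| ≤ |jEϖ|^m`.  The literal enters ONLY through `h_W`. [cite: Jacobowitz1962, §4] [cite: Rogawski1990, §4.9 Prop. 4.9.1 (b) p. 55]
[cite: Kottwitz1986BaseChangeUnits, §1 pp. 240–241] -/
theorem v_normFormTrace_sub_main_le_of_diag (σ : E →+* E) (hvσ : ∀ a, Valued.v (σ a) = Valued.v a) {ϖ : E} (hϖ1 : Valued.v ϖ ≤ 1)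
    (jE : E →+* M) (hjv : ∀ c, Valued.v (jE c) ≤ 1 ↔ Valued.v c ≤ 1)
    (hρj : ∀ c, ρ (jE c) = jE c) (hvρ : ∀ x, Valued.v (ρ x) = Valued.v x)
    (hΘΘ : ∀ x, Θ (Θ x) = x) (hvΘ : ∀ x, Valued.v (Θ x) = Valued.v x) (hΘj : ∀ c, Θ (jE c) = jE (σ c))
    {Y D₀ : M} {b : ℕ} (hYv : Valued.v Y ≤ Valued.v (jE ϖ) ^ b) (hD₀ : Valued.v D₀ = Valued.v (jE ϖ) ^ (2 * b)) (hD₀0 : D₀ ≠ 0)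
    {pw : E} (hTr : D₀⁻¹ + ρ D₀⁻¹ = jE pw)
    {g₁ hW : E} (hint : Valued.v (pw + σ g₁ * hW * g₁) ≤ 1)
    {m : ℕ} (hmb : m ≤ 2 * b)
    (htrace : ∀ w : M, Valued.v w ≤ Valued.v (jE ϖ) ^ b → Valued.v (w + Θ w) ≤ Valued.v (jE ϖ) ^ m)
    {μ : M} {f t : E} (hft : Valued.v (f * t) ≤ 1)
    (hlam : Valued.v (μ + jE (f * t * (ϖ * σ ϖ) ^ b)) ≤ Valued.v (jE ϖ) ^ (2 * b + m))
    {ζ : M} (hζ : Valued.v ζ ≤ 1) {a : E} (ha : Valued.v a ≤ 1) :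
    Valued.v (μ * ((Y * ζ + jE a) * Θ (Y * ζ + jE a)) / D₀ + ρ (μ * ((Y * ζ + jE a) * Θ (Y * ζ + jE a)) / D₀)
      - jE (f * hW * (t * ((ϖ ^ b * g₁ * a) * σ (ϖ ^ b * g₁ * a))))) ≤ Valued.v (jE ϖ) ^ m := by
  have hπ1 : Valued.v (jE ϖ) ≤ 1 := (hjv ϖ).2 hϖ1
  have hπmb : Valued.v (jE ϖ) ^ (2 * b) ≤ Valued.v (jE ϖ) ^ m := pow_le_pow_right_of_le_one' hπ1 hmb
  have hD₀v0 : Valued.v D₀ ≠ 0 := (Valuation.ne_zero_iff _).2 hD₀0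
  -- names
  set N : M := (Y * ζ + jE a) * Θ (Y * ζ + jE a) with hN
  set μE : E := -(f * t * (ϖ * σ ϖ) ^ b) with hμE
  set θ : M := μ + jE (f * t * (ϖ * σ ϖ) ^ b) with hθ
  set R : M := N - jE (a * σ a) with hR
  set I : E := pw + σ g₁ * hW * g₁ with hI
  -- valuations of the letters
  have hμEj : jE μE = -(jE (f * t) * (jE ϖ * Θ (jE ϖ)) ^ b) := by
    rw [hμE, map_neg, map_mul, map_pow, map_mul jE ϖ, hΘj]
  have hvμE : Valued.v (jE μE) ≤ Valued.v (jE ϖ) ^ (2 * b) := by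
    rw [hμEj, Valuation.map_neg, Valuation.map_mul, Valuation.map_pow, Valuation.map_mul, hvΘ, ← pow_two, ← pow_mul, mul_comm 2 b]
    calc Valued.v (jE (f * t)) * Valued.v (jE ϖ) ^ (b * 2) ≤ 1 * Valued.v (jE ϖ) ^ (b * 2) := by gcongr; exact (hjv _).2 hft
      _ = Valued.v (jE ϖ) ^ (b * 2) := one_mul _
  have hvN : Valued.v N ≤ 1 := by
    have h1 : Valued.v (Y * ζ + jE a) ≤ 1 := by
      refine (Valuation.map_add _ _ _).trans (max_le ?_ ((hjv a).2 ha))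
      rw [Valuation.map_mul]
      calc Valued.v Y * Valued.v ζ ≤ Valued.v (jE ϖ) ^ b * 1 := by gcongr
        _ ≤ 1 := by rw [mul_one]; exact pow_le_one' hπ1 _
    rw [hN, Valuation.map_mul, hvΘ]
    calc Valued.v (Y * ζ + jE a) * Valued.v (Y * ζ + jE a) ≤ 1 * 1 := by gcongr
      _ = 1 := one_mul _
  have hvR : Valued.v R ≤ Valued.v (jE ϖ) ^ m := v_normTheta_sub_norm_le σ hϖ1 jE hjv hΘΘ hvΘ hΘj hYv hmb htrace hζ ha
  have hvI : Valued.v (jE I) ≤ 1 := (hjv _).2 hint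
  have hvaa : Valued.v (jE (a * σ a)) ≤ 1 := (hjv _).2 (by rw [Valuation.map_mul, hvσ]; exact mul_le_one' ha ha)
  -- the algebraic decomposition of the difference
  have hμ : μ = jE μE + θ := by rw [hθ, hμE, map_neg]; ring
  have hNR : N = jE (a * σ a) + R := by rw [hR]; ring
  have hpw : pw = I - σ g₁ * hW * g₁ := by rw [hI]; ring
  have hmain : jE (f * hW * (t * ((ϖ ^ b * g₁ * a) * σ (ϖ ^ b * g₁ * a)))) = -(jE μE * jE (a * σ a) * jE (σ g₁ * hW * g₁)) := by
    rw [hμE, ← map_mul, ← map_mul, ← map_neg]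
    congr 1
    rw [map_mul, map_mul, map_pow]
    ring
  have hdiff : μ * N / D₀ + ρ (μ * N / D₀) - jE (f * hW * (t * ((ϖ ^ b * g₁ * a) * σ (ϖ ^ b * g₁ * a)))) =
      jE μE * jE (a * σ a) * jE I + (jE μE * R * D₀⁻¹ + ρ (jE μE * R * D₀⁻¹)) + (θ * N * D₀⁻¹ + ρ (θ * N * D₀⁻¹)) := by
    have hsplit : μ * N / D₀ = jE μE * jE (a * σ a) * D₀⁻¹ + jE μE * R * D₀⁻¹ + θ * N * D₀⁻¹ := by
      rw [hμ, div_eq_mul_inv]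
      conv_lhs => rw [hNR]
      ring
    have hρ1 : ρ (jE μE * jE (a * σ a) * D₀⁻¹) = jE μE * jE (a * σ a) * ρ D₀⁻¹ := by
      rw [map_mul, map_mul, hρj, hρj]
    rw [hmain, hsplit, map_add, map_add, hρ1]
    have hT : jE μE * jE (a * σ a) * D₀⁻¹ + jE μE * jE (a * σ a) * ρ D₀⁻¹ = jE μE * jE (a * σ a) * jE pw := by
      rw [← hTr]; ring
    rw [hpw, map_sub] at hT
    linear_combination hT
  rw [hdiff]
  refine (Valuation.map_add _ _ _).trans (max_le ((Valuation.map_add _ _ _).trans (max_le ?_ ?_)) ?_)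
  · -- the integrality term `jE(μE·aσa·I)`
    rw [Valuation.map_mul, Valuation.map_mul]
    calc Valued.v (jE μE) * Valued.v (jE (a * σ a)) * Valued.v (jE I) ≤ Valued.v (jE ϖ) ^ (2 * b) * 1 * 1 := by gcongr
      _ ≤ Valued.v (jE ϖ) ^ m := by rw [mul_one, mul_one]; exact hπmb
  · -- the cross terms
    refine v_add_map_le_of_le ρ hvρ ?_
    rw [Valuation.map_mul, Valuation.map_mul, map_inv₀, hD₀]
    calc Valued.v (jE μE) * Valued.v R * (Valued.v (jE ϖ) ^ (2 * b))⁻¹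
        ≤ Valued.v (jE ϖ) ^ (2 * b) * Valued.v (jE ϖ) ^ m * (Valued.v (jE ϖ) ^ (2 * b))⁻¹ := by gcongr
      _ = Valued.v (jE ϖ) ^ m := by rw [hD₀] at hD₀v0; field_simp
  · -- the `θ` term
    refine v_add_map_le_of_le ρ hvρ ?_
    rw [Valuation.map_mul, Valuation.map_mul, map_inv₀, hD₀]
    calc Valued.v θ * Valued.v N * (Valued.v (jE ϖ) ^ (2 * b))⁻¹
        ≤ Valued.v (jE ϖ) ^ (2 * b + m) * 1 * (Valued.v (jE ϖ) ^ (2 * b))⁻¹ := by gcongr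
      _ = Valued.v (jE ϖ) ^ m := by rw [hD₀] at hD₀v0; rw [pow_add]; field_simp

end Estimate

/-! ## §3 HEAD — the letter of an integral glued vertex over the diagonal cell is `valueSetMod σ ϖ m ((f·h_W) • X₊)` -/

section Head

variable {E M : Type} [Field E] [Valued E ℤᵐ⁰] [Field M] [Valued M ℤᵐ⁰] {ρ Θ : M →+* M} {α : M}

/-- `IsOrd ρ α cc 0`. [cite: Serre1979, Ch. V §3 Cor. 3] -/
theorem isOrd_zero (ρ : M →+* M) (α cc : M) : IsOrd ρ α cc 0 := by
  rw [isOrd_iff]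
  constructor <;> simp

omit [Valued E ℤᵐ⁰] [Valued M ℤᵐ⁰] in
/-- **`Tr_ρ(D₀⁻¹) = jE⟨w₀, w₀⟩_{H₂}`**: in ★ (C1)'s line model (`hform`) with `φ w₀ = Y⁻¹x₀` (`Y = dualGen ρ Θ α cc h_M x₀`), `D₀ = cc(α − ρα)·ΘY`:
`D₀⁻¹ + ρ D₀⁻¹ = jE (pairing σ H₂ w₀ w₀)` (★ p861372 `herm_dualGenInv_mul_eq` at `μ = η = 1`). [cite: Jacobowitz1962, §4] -/
theorem inv_add_map_inv_eq_map_pairing (σ : E →+* E) (H₂ : Matrix (Fin 2) (Fin 2) E) (jE : E →+* M) (hΘΘ : ∀ x, Θ (Θ x) = x)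
    (φ : (Fin 2 → E) →+ M) {hM : M} (hhM : hM ≠ 0) (hform : ∀ x y, jE (pairing σ H₂ x y) = hM * Θ (φ x) * φ y + ρ (hM * Θ (φ x) * φ y))
    {cc x₀ : M} (hcc : cc * (α - ρ α) ≠ 0) (hx₀ : x₀ ≠ 0) {w₀ : Fin 2 → E} (hw₀Y : φ w₀ = (dualGen ρ Θ α cc hM x₀)⁻¹ * x₀) :
    (cc * (α - ρ α) * Θ (dualGen ρ Θ α cc hM x₀))⁻¹ + ρ (cc * (α - ρ α) * Θ (dualGen ρ Θ α cc hM x₀))⁻¹ = jE (pairing σ H₂ w₀ w₀) := by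
  have h1 : hM * Θ (φ w₀) * φ w₀ = (cc * (α - ρ α) * Θ (dualGen ρ Θ α cc hM x₀))⁻¹ := by
    have h := herm_dualGenInv_mul_eq (ρ := ρ) (α := α) hΘΘ hcc hhM hx₀ (1 : M) (1 : M)
    rw [mul_one, one_mul, map_one, mul_one, one_mul, one_div] at h
    rw [hw₀Y, h]
  rw [hform, h1]

/-- **HEAD — «THE LETTER OF THE DIAGONAL CELL IS `(f·h_W) • X₊`».**  Frame of ★ p861372 HEAD B `valueSet_endoGL_sub_one_glued_eq_normFormSet_of_gen` VERBATIM (the plane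
`(E², H₂)` with `σ` isometric, `|ϖ| = exp(−1)`, block form `H = block(H₂, h_W)`, `Γ = endoGL (γ₂, u)` with `|u₀₀ − 1| ≤ |ϖ^m|`; ★ (C1)'s line model `(M, jE, ρ, Θ; φ, lam, h_M)`
with `ρ ∘ jE = jE`, `Θ ∘ jE = jE ∘ σ`, `ρ, Θ` isometric; an INTEGRAL vertex `L` glued over `(B₂, w₀)` with generator `g₀`, `|g₀ 1|·|ϖ|^b = 1`; the presentation `φ(B₂) = Λ = x₀·𝒪_cc`,
`φ w₀ = Y⁻¹x₀`, `Y = dualGen ρ Θ α cc h_M x₀`) PLUS the letters of the DIAGONAL CELL: `|Y| = |jEϖ|^b` (level = tube depth), `|cc(α − ρα)| = |jEϖ|^b` (order level = tube depth,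
`|α − ρα| = 1`), `m ≤ 2b`, the trace hypothesis `htrace` (`Θ`-traces of `𝔭_M^b` lie in `𝔭_M^m`; at a wild datum `b ≥ d`), and the CLEAN-REGIME letter
`hlam : |lam − jE u₀₀ + jE(f·t₊·(ϖσϖ)^b)| ≤ |jEϖ|^{2b+m}` (`t₊ = (ϖ − σϖ)·((ϖσϖ)^{⌊d∕2⌋})⁻¹` ★ №3's reference skew scalar, `|f·t₊| ≤ 1`).  THEN the `ϖ^m`-value set of `Γ − 1` on `L` is
`valueSetMod σ ϖ m ((f·h_W) • xPlus σ ϖ d)` — ONE class for the whole cell, and the literal enters ONLY through the line entry `h_W`.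
[cite: Jacobowitz1962, §4] [cite: Rogawski1990, §4.9 Prop. 4.9.1 (b) p. 55] [cite: Kottwitz1986BaseChangeUnits, §1 pp. 240–241] [cite: LanglandsShelstad1987, §1–§3] -/
theorem valueSet_endoGL_sub_one_glued_eq_smul_xPlus_of_diag (σ : E →+* E) (hvσ : ∀ a, Valued.v (σ a) = Valued.v a) {ϖ : E} (hϖ : Valued.v ϖ = exp (-1 : ℤ))
    (H₂ : Matrix (Fin 2) (Fin 2) E) (h : E) (d : ℕ)
    (jE : E →+* M) (hjv : ∀ c, Valued.v (jE c) ≤ 1 ↔ Valued.v c ≤ 1) (hρj : ∀ c, ρ (jE c) = jE c) (hvρ : ∀ x, Valued.v (ρ x) = Valued.v x)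
    (hΘΘ : ∀ x, Θ (Θ x) = x) (hvΘ : ∀ x, Valued.v (Θ x) = Valued.v x) (hΘj : ∀ c, Θ (jE c) = jE (σ c))
    (φ : (Fin 2 → E) →+ M) (hφs : ∀ (c : E) (x : Fin 2 → E), φ (c • x) = jE c * φ x)
    {γ₂ : GL (Fin 2) E} {lam hM : M} (hφγ : ∀ x, φ ((γ₂ : Matrix (Fin 2) (Fin 2) E) *ᵥ x) = lam * φ x) (hhM : hM ≠ 0)
    (hform : ∀ x y, jE (pairing σ H₂ x y) = hM * Θ (φ x) * φ y + ρ (hM * Θ (φ x) * φ y))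
    {L : Submodule 𝒪[E] (Fin 3 → E)} {b : ℕ} (hpr : ∀ x ∈ L, Valued.v (x 1) * Valued.v ϖ ^ b ≤ 1)
    (hint : ∀ y ∈ L, Valued.v (pairing σ (!![H₂ 0 0, 0, H₂ 0 1; 0, h, 0; H₂ 1 0, 0, H₂ 1 1] : Matrix (Fin 3) (Fin 3) E) y y) ≤ 1)
    {B₂ : Submodule 𝒪[E] (Fin 2 → E)} {w₀ : Fin 2 → E} {g₀ : Fin 3 → E}
    (hB : B₂.map ((Matrix.toLin' (!![1, 0; 0, 0; 0, 1] : Matrix (Fin 3) (Fin 2) E)).restrictScalars 𝒪[E]) =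
      L ⊓ LinearMap.ker ((LinearMap.proj (1 : Fin 3) : (Fin 3 → E) →ₗ[E] E).restrictScalars 𝒪[E]))
    (hg₀ : g₀ ∈ L) (hg₀1 : Valued.v (g₀ 1) * Valued.v ϖ ^ b = 1) (hprg : g₀ - Pi.single 1 (g₀ 1) = ![w₀ 0, 0, w₀ 1])
    (u : GL (Fin 1) E) (m : ℕ) (hum : Valued.v ((u : Matrix (Fin 1) (Fin 1) E) 0 0 - 1) ≤ Valued.v (ϖ ^ m))
    {cc x₀ : M} (hcc : cc * (α - ρ α) ≠ 0) (hx₀ : x₀ ≠ 0) {Λ : AddSubgroup M} (hBΛ : B₂.toAddSubgroup.map φ = Λ)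
    (hΛx : ∀ x, x ∈ Λ ↔ ∃ ζ, IsOrd ρ α cc ζ ∧ x = x₀ * ζ) (hw₀Y : φ w₀ = (dualGen ρ Θ α cc hM x₀)⁻¹ * x₀)
    -- the letters of the diagonal cell
    (hylev : Valued.v (dualGen ρ Θ α cc hM x₀) = Valued.v (jE ϖ) ^ b) (hccv : Valued.v (cc * (α - ρ α)) = Valued.v (jE ϖ) ^ b)
    (hmb : m ≤ 2 * b) (htrace : ∀ w : M, Valued.v w ≤ Valued.v (jE ϖ) ^ b → Valued.v (w + Θ w) ≤ Valued.v (jE ϖ) ^ m)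
    (f : E) (hft : Valued.v (f * ((ϖ - σ ϖ) * ((ϖ * σ ϖ) ^ ((d - d % 2) / 2))⁻¹)) ≤ 1)
    (hlam : Valued.v (lam - jE ((u : Matrix (Fin 1) (Fin 1) E) 0 0) + jE (f * ((ϖ - σ ϖ) * ((ϖ * σ ϖ) ^ ((d - d % 2) / 2))⁻¹) * (ϖ * σ ϖ) ^ b)) ≤
      Valued.v (jE ϖ) ^ (2 * b + m)) :
    {z : E | ∃ y ∈ L, Valued.v ((ϖ ^ m)⁻¹ * (z - pairing σ (!![H₂ 0 0, 0, H₂ 0 1; 0, h, 0; H₂ 1 0, 0, H₂ 1 1] : Matrix (Fin 3) (Fin 3) E) y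
        ((((endoGL (γ₂, u) : GL (Fin 3) E) : Matrix (Fin 3) (Fin 3) E) - 1) *ᵥ y))) ≤ 1} =
      valueSetMod σ ϖ m ((f * h) • xPlus σ ϖ d) := by
  rw [valueSet_endoGL_sub_one_glued_eq_normFormSet_of_gen σ hϖ H₂ h jE hjv hΘΘ φ hφs hφγ hhM hform hpr hint hB hg₀ hg₀1 hprg u m hum hcc hx₀ hBΛ hΛx hw₀Y,
    valueSetMod_smul_xPlus]
  -- names
  set Y : M := dualGen ρ Θ α cc hM x₀ with hYdef
  set D₀ : M := cc * (α - ρ α) * Θ Y with hD₀def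
  set μ : M := lam - jE ((u : Matrix (Fin 1) (Fin 1) E) 0 0) with hμdef
  set t : E := (ϖ - σ ϖ) * ((ϖ * σ ϖ) ^ ((d - d % 2) / 2))⁻¹ with htdef
  have hvϖ0 : Valued.v ϖ ≠ 0 := by rw [hϖ]; exact WithZero.exp_ne_zero
  have hϖ0 : ϖ ≠ 0 := fun h0 => by rw [h0, map_zero] at hvϖ0; exact hvϖ0 rfl
  have hϖ1 : Valued.v ϖ ≤ 1 := by rw [hϖ, ← WithZero.exp_zero, WithZero.exp_le_exp]; norm_num
  have hY0 : Y ≠ 0 := by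
    rw [hYdef, dualGen_def]; exact mul_ne_zero (mul_ne_zero hhM (mul_ne_zero hx₀ ((map_ne_zero Θ).2 hx₀))) hcc
  have hD₀0 : D₀ ≠ 0 := mul_ne_zero hcc ((map_ne_zero Θ).2 hY0)
  have hD₀ : Valued.v D₀ = Valued.v (jE ϖ) ^ (2 * b) := by
    rw [hD₀def, Valuation.map_mul, hvΘ, hccv, hylev, two_mul, pow_add]
  -- the glue letters: `Tr_ρ(D₀⁻¹) = jE⟨w₀,w₀⟩`, integrality of `g₀`, the unit `ϖ^b·g₀ 1`
  have hTr : D₀⁻¹ + ρ D₀⁻¹ = jE (pairing σ H₂ w₀ w₀) := inv_add_map_inv_eq_map_pairing σ H₂ jE hΘΘ φ hhM hform hcc hx₀ hw₀Y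
  have hw₀g : (![g₀ 0, g₀ 2] : Fin 2 → E) = w₀ := by
    have h0 := congrFun hprg 0
    have h2 := congrFun hprg 2
    simp only [Pi.sub_apply, Pi.single_apply] at h0 h2
    ext i; fin_cases i <;> simp_all
  have hintg : Valued.v (pairing σ H₂ w₀ w₀ + σ (g₀ 1) * h * g₀ 1) ≤ 1 := by
    have h1 := hint g₀ hg₀
    rwa [pairing_self_eq_plane_add_line σ H₂ h g₀, hw₀g] at h1
  have hu₀ : Valued.v (ϖ ^ b * g₀ 1) = 1 := by rw [Valuation.map_mul, Valuation.map_pow, mul_comm]; exact hg₀1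
  -- the two sides, member by member
  ext z
  simp only [Set.mem_setOf_eq]
  rw [← exists_v_le_one_mul_unit_iff hu₀ (fun a => Valued.v ((ϖ ^ m)⁻¹ * (z - f * h * (t * (a * σ a)))) ≤ 1)]
  have hkey : ∀ (ζ : M) (a : E), IsOrd ρ α cc ζ → Valued.v a ≤ 1 →
      (Valued.v ((jE ϖ ^ m)⁻¹ * (jE z - (μ * ((Y * ζ + jE a) * Θ (Y * ζ + jE a)) / D₀ + ρ (μ * ((Y * ζ + jE a) * Θ (Y * ζ + jE a)) / D₀)))) ≤ 1 ↔
        Valued.v ((ϖ ^ m)⁻¹ * (z - f * h * (t * ((ϖ ^ b * g₀ 1 * a) * σ (ϖ ^ b * g₀ 1 * a))))) ≤ 1) := by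
    intro ζ a hζ ha
    have hest := v_normFormTrace_sub_main_le_of_diag σ hvσ hϖ1 jE hjv hρj hvρ hΘΘ hvΘ hΘj (le_of_eq hylev) hD₀ hD₀0 hTr hintg (hW := h) hmb htrace hft
      (μ := μ) hlam hζ.1 ha
    set V : M := μ * ((Y * ζ + jE a) * Θ (Y * ζ + jE a)) / D₀ + ρ (μ * ((Y * ζ + jE a) * Θ (Y * ζ + jE a)) / D₀) with hV
    set V₀ : E := f * h * (t * ((ϖ ^ b * g₀ 1 * a) * σ (ϖ ^ b * g₀ 1 * a))) with hV₀
    have hsplit : V = jE V₀ + (V - jE V₀) := by ring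
    rw [hsplit, v_inv_mul_sub_add_le_one_iff (pow_ne_zero _ ((map_ne_zero jE).2 hϖ0)) (by rw [Valuation.map_pow]; exact hest),
      ← v_thicken_iff_map jE hjv]
  constructor
  · rintro ⟨ζ, a, hζ, ha, hz⟩
    exact ⟨a, ha, (hkey ζ a hζ ha).1 hz⟩
  · rintro ⟨a, ha, hz⟩
    exact ⟨0, a, isOrd_zero ρ α cc, ha, (hkey 0 a (isOrd_zero ρ α cc) ha).2 hz⟩

end Head

/-! ## §4 (appended) The trace letter `htrace` from a ramified `Θ`-datum on `M`; the HEAD at the level of record `m* = mstarOfRecord d` -/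

section Datum

variable {E M : Type} [Field E] [Valued E ℤᵐ⁰] [Field M] [Valued M ℤᵐ⁰] {ρ Θ : M →+* M} {α : M}

/-- **THE TRACE LETTER FROM THE DATUM**: for `IsRamifiedQuadraticDatum Θ ϖM d t` on `M` (★ p857929's RamK block, `ϖM = jE ϖ`) and `d ≤ b`, every `|w| ≤ |ϖM|^b` has
`|w + Θw| ≤ |ϖM|^{mstarOfRecord d}` (★ `v_add_map_le_exp` at `2d ≤ b + d`; `mstarOfRecord d ≤ 2d`). [cite: Serre1979, Ch. III §3 Prop. 7] -/
theorem v_add_map_le_varpi_pow_mstar_of_datum {ϖM : M} {d t : ℕ} (hD : IsRamifiedQuadraticDatum Θ ϖM d t) {b : ℕ} (hdb : d ≤ b)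
    {w : M} (hw : Valued.v w ≤ Valued.v ϖM ^ b) : Valued.v (w + Θ w) ≤ Valued.v ϖM ^ mstarOfRecord d := by
  obtain ⟨hΘΘ, -, hϖM, hfix, hdd, -, ht⟩ := hD
  rw [Literature.NumberTheory.LocalFields.WildQuadraticDatum.v_varpi_pow hϖM] at hw ⊢
  have h1 : Valued.v (w + Θ w) ≤ exp (-(2 * (d : ℤ))) :=
    Literature.NumberTheory.LocalFields.WildQuadraticDatum.v_add_map_le_exp hΘΘ hfix hϖM hdd ht (j := (b : ℤ)) (m := (d : ℤ)) hw (by omega)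
  refine h1.trans (exp_le_exp.2 ?_)
  simp only [mstarOfRecord]
  omega

/-- **HEAD′ — §3 AT THE LEVEL OF RECORD `m* = mstarOfRecord d` WITH `htrace` DISCHARGED BY THE DATUM** `IsRamifiedQuadraticDatum Θ (jE ϖ) d t` on `M` (the `hDΘ` of LH4-p04's
`beta2CellsBFrame` ∕ ★ p857929's RamK block; `d ≤ b ⟸ m* ≤ 2b`).  Remaining letters: the D-cell valuations `hylev`∕`hccv`, the regime `hmb : m* ≤ 2b`, the clean letter `hlam`.
[cite: Jacobowitz1962, §4] [cite: Rogawski1990, §4.9 Prop. 4.9.1 (b) p. 55] [cite: Kottwitz1986BaseChangeUnits, §1 pp. 240–241] [cite: Serre1979, Ch. III §3 Prop. 7] -/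
theorem valueSet_endoGL_sub_one_glued_eq_smul_xPlus_of_diag_of_datum (σ : E →+* E) (hvσ : ∀ a, Valued.v (σ a) = Valued.v a) {ϖ : E} (hϖ : Valued.v ϖ = exp (-1 : ℤ))
    (H₂ : Matrix (Fin 2) (Fin 2) E) (h : E) {d t : ℕ}
    (jE : E →+* M) (hjv : ∀ c, Valued.v (jE c) ≤ 1 ↔ Valued.v c ≤ 1) (hρj : ∀ c, ρ (jE c) = jE c) (hvρ : ∀ x, Valued.v (ρ x) = Valued.v x)
    (hDM : IsRamifiedQuadraticDatum Θ (jE ϖ) d t) (hΘj : ∀ c, Θ (jE c) = jE (σ c))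
    (φ : (Fin 2 → E) →+ M) (hφs : ∀ (c : E) (x : Fin 2 → E), φ (c • x) = jE c * φ x)
    {γ₂ : GL (Fin 2) E} {lam hM : M} (hφγ : ∀ x, φ ((γ₂ : Matrix (Fin 2) (Fin 2) E) *ᵥ x) = lam * φ x) (hhM : hM ≠ 0)
    (hform : ∀ x y, jE (pairing σ H₂ x y) = hM * Θ (φ x) * φ y + ρ (hM * Θ (φ x) * φ y))
    {L : Submodule 𝒪[E] (Fin 3 → E)} {b : ℕ} (hpr : ∀ x ∈ L, Valued.v (x 1) * Valued.v ϖ ^ b ≤ 1)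
    (hint : ∀ y ∈ L, Valued.v (pairing σ (!![H₂ 0 0, 0, H₂ 0 1; 0, h, 0; H₂ 1 0, 0, H₂ 1 1] : Matrix (Fin 3) (Fin 3) E) y y) ≤ 1)
    {B₂ : Submodule 𝒪[E] (Fin 2 → E)} {w₀ : Fin 2 → E} {g₀ : Fin 3 → E}
    (hB : B₂.map ((Matrix.toLin' (!![1, 0; 0, 0; 0, 1] : Matrix (Fin 3) (Fin 2) E)).restrictScalars 𝒪[E]) =
      L ⊓ LinearMap.ker ((LinearMap.proj (1 : Fin 3) : (Fin 3 → E) →ₗ[E] E).restrictScalars 𝒪[E]))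
    (hg₀ : g₀ ∈ L) (hg₀1 : Valued.v (g₀ 1) * Valued.v ϖ ^ b = 1) (hprg : g₀ - Pi.single 1 (g₀ 1) = ![w₀ 0, 0, w₀ 1])
    (u : GL (Fin 1) E) (hum : Valued.v ((u : Matrix (Fin 1) (Fin 1) E) 0 0 - 1) ≤ Valued.v (ϖ ^ mstarOfRecord d))
    {cc x₀ : M} (hcc : cc * (α - ρ α) ≠ 0) (hx₀ : x₀ ≠ 0) {Λ : AddSubgroup M} (hBΛ : B₂.toAddSubgroup.map φ = Λ)
    (hΛx : ∀ x, x ∈ Λ ↔ ∃ ζ, IsOrd ρ α cc ζ ∧ x = x₀ * ζ) (hw₀Y : φ w₀ = (dualGen ρ Θ α cc hM x₀)⁻¹ * x₀)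
    -- the letters of the diagonal cell
    (hylev : Valued.v (dualGen ρ Θ α cc hM x₀) = Valued.v (jE ϖ) ^ b) (hccv : Valued.v (cc * (α - ρ α)) = Valued.v (jE ϖ) ^ b)
    (hmb : mstarOfRecord d ≤ 2 * b)
    (f : E) (hft : Valued.v (f * ((ϖ - σ ϖ) * ((ϖ * σ ϖ) ^ ((d - d % 2) / 2))⁻¹)) ≤ 1)
    (hlam : Valued.v (lam - jE ((u : Matrix (Fin 1) (Fin 1) E) 0 0) + jE (f * ((ϖ - σ ϖ) * ((ϖ * σ ϖ) ^ ((d - d % 2) / 2))⁻¹) * (ϖ * σ ϖ) ^ b)) ≤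
      Valued.v (jE ϖ) ^ (2 * b + mstarOfRecord d)) :
    {z : E | ∃ y ∈ L, Valued.v ((ϖ ^ mstarOfRecord d)⁻¹ * (z - pairing σ (!![H₂ 0 0, 0, H₂ 0 1; 0, h, 0; H₂ 1 0, 0, H₂ 1 1] : Matrix (Fin 3) (Fin 3) E) y
        ((((endoGL (γ₂, u) : GL (Fin 3) E) : Matrix (Fin 3) (Fin 3) E) - 1) *ᵥ y))) ≤ 1} =
      valueSetMod σ ϖ (mstarOfRecord d) ((f * h) • xPlus σ ϖ d) := by
  have hdb : d ≤ b := by simp only [mstarOfRecord] at hmb; omega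
  exact valueSet_endoGL_sub_one_glued_eq_smul_xPlus_of_diag σ hvσ hϖ H₂ h d jE hjv hρj hvρ hDM.1 hDM.2.1 hΘj φ hφs hφγ hhM hform hpr hint hB hg₀ hg₀1 hprg u
    (mstarOfRecord d) hum hcc hx₀ hBΛ hΛx hw₀Y hylev hccv hmb (fun w hw => v_add_map_le_varpi_pow_mstar_of_datum hDM hdb hw) f hft hlam

end Datum

end Summit.HodgeConjecture.HodgeConjecture.Cruxes.H413.F0P3cDyRamDiagonalCellLetter

end
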